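import Literature.NumberTheory.EllipticCurves.DivisionPolynomialTorsion
import Literature.AlgebraicGeometry.PlaneCurves.HessePencilCharacteristicThreeWeierstrass
import HarnessLib

/-!
# The `3`-torsion of a nonsingular member in characteristic `3`: exactly the three base points (Artebani–Dolgachev, Remark 2.1)

Topic `Literature/AlgebraicGeometry/PlaneCurves`, namespace `Literature.AlgebraicGeometry.PlaneCurves`.
Lane `lit-hodgefound`, seat `lit-hodgefound-p37`, row g21-#7; sequel of
`HessePencilCharacteristicThreeWeierstrass` (g21-#3: the model `W₃[t] = ⟨−t, 0, 0, 0, t³⟩` of `E_t`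
through `M_t`, `3 = 0`, `t ≠ 0`) using the tree's `DivisionPolynomialTorsion`
(`WeierstrassCurve.three_smul_some_eq_zero_iff`: `3P = O ↔ Ψ₃(x) = 0` for `2P ≠ O`).  Everything
here is PROVED; no definition, no named fact.

Source — M. Artebani, I. Dolgachev, *The Hesse pencil of plane cubic curves*, Enseign. Math. (2) 55
(2009), §2, Remark 2.1 [`paper:arxiv-math_0611590` p0005 L62], VERBATIM: "The Hesse pencil (2) in
characteristic 3 has two singular members: `(x + y + z)³ = 0` and `xyz = 0`.  It has three base points
`(1, −1, 0), (0, 1, −1), (1, 0, −1)`, each of multiplicity 3, which are the inflection points of all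
nonsingular members of the pencil."; and §2 [p0004 L7]: "The set of inflection points is the group
of 3-torsion points of each member of the Hesse pencil."

## The computation

For `W₃[t]`: `b₂ = t²`, `b₄ = 0`, `b₆ = 4t³`, `b₈ = t⁵`, so for `3 = 0` the `3`-division polynomial
is `Ψ₃(x) = 3x⁴ + b₂x³ + 3b₄x² + 3b₆x + b₈ = t²x³ + t⁵ = t²(x + t)³` (§1): a non-zero `3`-torsion
point has `x = −t`, and then `y² + t²y = 0`, `y ∈ {0, −t²}` (§2).  Hence
`W₃[t](K)[3] = {O, (−t, 0), (−t, −t²)}` — THREE points over every field of characteristic `3`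
(§2, §3), and their Hesse points `M_t vec P` are `t⁻¹·(1, −1, 0)`, `−t·(0, 1, −1)`, `−t·(1, 0, −1)`:
the three base points (§3).

## What is here

* §1 `charThree_Ψ₃_eval` (`Ψ₃(x) = t²(x + t)³`), `charThree_negY` (`−(x, y) = (x, −y + tx)`).
* §2 **`charThree_three_nsmul_eq_zero_iff`**: `3P = O ↔ P = O ∨ P = (−t, 0) ∨ P = (−t, −t²)`;
  `charThree_nonsingular_torsionPoints` (both are points of `W₃[t]`).
* §3 **`charThree_ncard_threeTorsion`** (`#{P | 3P = O} = 3`) and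
  **`charThree_threeTorsion_hessePoints`** (they lie over `(1, −1, 0)`, `(0, 1, −1)`, `(1, 0, −1)`).

## References
* [ArtebaniDolgachev2009] M. Artebani, I. Dolgachev, *The Hesse pencil of plane cubic curves*,
  Enseign. Math. (2) 55 (2009) 235–273, §2, Remark 2.1.
* [SilvermanAEC2009] J. H. Silverman, *The Arithmetic of Elliptic Curves*, 2nd ed., GTM 106,
  Exercise 3.7 (division polynomials).
-/

set_option autoImplicit false

open MvPolynomial Matrix
open Literature.NumberTheory.EllipticCurves

namespace Literature.AlgebraicGeometry.PlaneCurves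

universe u

/-- `M_t = [[0, t⁻¹, 0], [1, −t⁻¹, 0], [0, 0, t]]` (g21-#3; local notation). -/
local notation3 "𝐌[" t "]" =>
  (Matrix.of ![![(0 : _), t⁻¹, 0], ![1, -t⁻¹, 0], ![0, 0, t]] : Matrix (Fin 3) (Fin 3) _)

/-- `W₃[t] = ⟨−t, 0, 0, 0, t³⟩` (g21-#3; local notation). -/
local notation3 "𝐖₃[" t "]" =>
  ({ a₁ := -t, a₂ := 0, a₃ := 0, a₄ := 0, a₆ := t ^ 3 } : WeierstrassCurve _)

section CharThreeTorsion

variable {K : Type u} [Field K]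

/-! ## §1 The `3`-division polynomial of `W₃[t]` in characteristic `3` -/

/-- **`Ψ₃(x) = t²(x + t)³`** for `W₃[t]` when `3 = 0` (`b₂ = t²`, `b₄ = 0`, `b₆ = 4t³`, `b₈ = t⁵`).
[cite: SilvermanAEC2009, Exercise 3.7 (the division polynomial `ψ₃`)] -/
theorem charThree_Ψ₃_eval (h3 : (3 : K) = 0) (t x : K) :
    ((𝐖₃[t] : WeierstrassCurve K).Ψ₃).eval x = t ^ 2 * (x + t) ^ 3 := by
  simp only [WeierstrassCurve.Ψ₃, WeierstrassCurve.b₂, WeierstrassCurve.b₄, WeierstrassCurve.b₆,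
    WeierstrassCurve.b₈, Polynomial.eval_add, Polynomial.eval_mul, Polynomial.eval_pow,
    Polynomial.eval_C, Polynomial.eval_X, Polynomial.eval_ofNat]
  linear_combination (x ^ 4 + 4 * t ^ 3 * x - t ^ 3 * x ^ 2 - t ^ 4 * x) * h3

/-- The negation of `W₃[t]`: `negY x y = −y + tx`. [cite: SilvermanAEC2009, III.2.3 (Group Law
Algorithm)] -/
theorem charThree_negY (t x y : K) : (𝐖₃[t] : WeierstrassCurve K).toAffine.negY x y = -y + t * x := by
  simp only [WeierstrassCurve.Affine.negY]
  ring

/-! ## §2 `W₃[t](K)[3] = {O, (−t, 0), (−t, −t²)}` -/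

/-- `(−t, 0)` and `(−t, −t²)` are (nonsingular) points of `W₃[t]` (`3 = 0`, `t ≠ 0`).
[cite: ArtebaniDolgachev2009, §2, Remark 2.1 (the base points of a nonsingular member)] -/
theorem charThree_nonsingular_torsionPoints (h3 : (3 : K) = 0) {t : K} (ht : t ≠ 0) :
    (𝐖₃[t] : WeierstrassCurve K).toAffine.Nonsingular (-t) 0 ∧
      (𝐖₃[t] : WeierstrassCurve K).toAffine.Nonsingular (-t) (-t ^ 2) := by
  haveI : (𝐖₃[t] : WeierstrassCurve K).IsElliptic := (charThree_weierstrass_isElliptic_iff h3 t).2 ht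
  constructor
  · refine (WeierstrassCurve.Affine.equation_iff_nonsingular
      (W := (𝐖₃[t] : WeierstrassCurve K).toAffine)).1 ?_
    rw [WeierstrassCurve.Affine.equation_iff]
    ring
  · refine (WeierstrassCurve.Affine.equation_iff_nonsingular
      (W := (𝐖₃[t] : WeierstrassCurve K).toAffine)).1 ?_
    rw [WeierstrassCurve.Affine.equation_iff]
    ring

/-- **The `3`-torsion of `W₃[t]` over any field with `3 = 0` (`t ≠ 0`) is `{O, (−t, 0), (−t, −t²)}`**:
`3P = O` iff `P = O` or `P = (−t, 0)` or `P = (−t, −t²)` ("three base points … which are the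
inflection points of all nonsingular members"; the inflection points are the `3`-torsion points).
[cite: ArtebaniDolgachev2009, §2, Remark 2.1; §2 ("The set of inflection points is the group of
3-torsion points")] -/
theorem charThree_three_nsmul_eq_zero_iff [DecidableEq K] (h3 : (3 : K) = 0) {t : K} (ht : t ≠ 0)
    (P : (𝐖₃[t] : WeierstrassCurve K).toAffine.Point) :
    3 • P = 0 ↔ P = 0 ∨ (∃ h, P = .some (-t) 0 h) ∨ (∃ h, P = .some (-t) (-t ^ 2) h) := by
  -- `(3 : ℕ) • P = 0 ↔ (3 : ℤ) • P = 0`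
  have hz : ∀ Q : (𝐖₃[t] : WeierstrassCurve K).toAffine.Point, 3 • Q = 0 ↔ (3 : ℤ) • Q = 0 :=
    fun Q => by rw [show (3 : ℤ) = ((3 : ℕ) : ℤ) from rfl, natCast_zsmul]
  constructor
  · intro h3P
    rcases P with _ | ⟨x, y, hns⟩
    · exact Or.inl rfl
    · right
      set P : (𝐖₃[t] : WeierstrassCurve K).toAffine.Point := .some x y hns with hP
      -- `P` is not `2`-torsion (else `3P = P ≠ O`)
      have hy : y ≠ (𝐖₃[t] : WeierstrassCurve K).toAffine.negY x y := by
        intro hyy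
        have h2 : P + P = 0 := by
          nth_rewrite 2 [show P = -P by rw [hP, WeierstrassCurve.Affine.Point.neg_some]; congr]
          exact add_neg_cancel _
        have h3' : 3 • P = P := by
          rw [show 3 • P = 2 • P + P from succ_nsmul P 2, two_nsmul, h2, zero_add]
        rw [h3'] at h3P
        exact WeierstrassCurve.Affine.Point.some_ne_zero hns h3P
      have hΨ := (WeierstrassCurve.three_smul_some_eq_zero_iff hns hy).mp ((hz P).1 h3P)
      rw [WeierstrassCurve.ψ_three, Polynomial.evalEval_C, charThree_Ψ₃_eval h3] at hΨ
      have hx : x = -t := by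
        have h' : (x + t) ^ 3 = 0 := (mul_eq_zero.1 hΨ).resolve_left (pow_ne_zero 2 ht)
        linear_combination (pow_eq_zero_iff three_ne_zero).1 h'
      subst hx
      have heq := (WeierstrassCurve.Affine.equation_iff ..).mp hns.left
      have hy2 : y * (y + t ^ 2) = 0 := by linear_combination heq
      rcases mul_eq_zero.1 hy2 with hy0 | hy1
      · subst hy0; exact Or.inl ⟨hns, rfl⟩
      · have hy' : y = -t ^ 2 := by linear_combination hy1
        subst hy'; exact Or.inr ⟨hns, rfl⟩
  · rintro (rfl | ⟨h, rfl⟩ | ⟨h, rfl⟩)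
    · simp
    · refine (hz _).2 ((WeierstrassCurve.three_smul_some_eq_zero_iff h ?_).mpr ?_)
      · rw [charThree_negY]
        intro h0
        apply ht
        have : t ^ 2 = 0 := by linear_combination h0
        exact (pow_eq_zero_iff two_ne_zero).1 this
      · rw [WeierstrassCurve.ψ_three, Polynomial.evalEval_C, charThree_Ψ₃_eval h3]; ring
    · refine (hz _).2 ((WeierstrassCurve.three_smul_some_eq_zero_iff h ?_).mpr ?_)
      · rw [charThree_negY]
        intro h0
        apply ht
        have : t ^ 2 = 0 := by linear_combination -h0
        exact (pow_eq_zero_iff two_ne_zero).1 this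
      · rw [WeierstrassCurve.ψ_three, Polynomial.evalEval_C, charThree_Ψ₃_eval h3]; ring

/-! ## §3 Three points, over the three base points -/

/-- **`#W₃[t](K)[3] = 3`** over every field with `3 = 0` (`t ≠ 0`) — in characteristic `3` a
nonsingular member has exactly THREE inflection points (contrast: nine when `3 ≠ 0`,
`WeierstrassNineFlexes.card_torsionBy_three`). [cite: ArtebaniDolgachev2009, §2, Remark 2.1
("three base points … which are the inflection points of all nonsingular members")] -/
theorem charThree_ncard_threeTorsion [DecidableEq K] (h3 : (3 : K) = 0) {t : K} (ht : t ≠ 0) :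
    ({P | 3 • P = 0} : Set (𝐖₃[t] : WeierstrassCurve K).toAffine.Point).ncard = 3 := by
  obtain ⟨h1, h2⟩ := charThree_nonsingular_torsionPoints h3 ht
  rw [Set.ncard_eq_three]
  refine ⟨0, .some (-t) 0 h1, .some (-t) (-t ^ 2) h2, ?_, ?_, ?_, ?_⟩
  · exact fun h => WeierstrassCurve.Affine.Point.some_ne_zero h1 h.symm
  · exact fun h => WeierstrassCurve.Affine.Point.some_ne_zero h2 h.symm
  · intro h
    rw [WeierstrassCurve.Affine.Point.some.injEq] at h
    apply ht
    have : t ^ 2 = 0 := by linear_combination h.2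
    exact (pow_eq_zero_iff two_ne_zero).1 this
  · ext P
    rw [Set.mem_setOf_eq, charThree_three_nsmul_eq_zero_iff h3 ht]
    simp only [Set.mem_insert_iff, Set.mem_singleton_iff]
    constructor
    · rintro (rfl | ⟨h, rfl⟩ | ⟨h, rfl⟩)
      · exact Or.inl rfl
      · exact Or.inr (Or.inl rfl)
      · exact Or.inr (Or.inr rfl)
    · rintro (rfl | rfl | rfl)
      · exact Or.inl rfl
      · exact Or.inr (Or.inl ⟨h1, rfl⟩)
      · exact Or.inr (Or.inr ⟨h2, rfl⟩)

/-- **The three `3`-torsion points lie over the three base points**: with `vec O = (0, 1, 0)`,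
`vec (x, y) = (x, y, 1)`: `M_t(0, 1, 0) = t⁻¹·(1, −1, 0)`, `M_t(−t, 0, 1) = −t·(0, 1, −1)`,
`M_t(−t, −t², 1) = −t·(1, 0, −1)` — Remark 2.1's base points `(1, −1, 0), (0, 1, −1), (1, 0, −1)` are
the images of `O, (−t, 0), (−t, −t²)`; in particular `(−t, −t²)` is the point `T` over `(1, 0, −1)` of
`HessePencilCharacteristicThreeTranslation` (`c_T = −t`) and `(−t, 0) = 2T = −T`.
[cite: ArtebaniDolgachev2009, §2, Remark 2.1; §5, Remark 5.5] -/
theorem charThree_threeTorsion_hessePoints {t : K} (ht : t ≠ 0) :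
    (𝐌[t] : Matrix (Fin 3) (Fin 3) K) *ᵥ ![0, 1, 0] = t⁻¹ • ![(1 : K), -1, 0] ∧
      (𝐌[t] : Matrix (Fin 3) (Fin 3) K) *ᵥ ![-t, 0, 1] = (-t) • ![(0 : K), 1, -1] ∧
      (𝐌[t] : Matrix (Fin 3) (Fin 3) K) *ᵥ ![-t, -t ^ 2, 1] = (-t) • ![(1 : K), 0, -1] := by
  refine ⟨charThree_matrix_mulVec_O t, ?_, ?_⟩
  · funext i; fin_cases i <;> simp [Matrix.mulVec, dotProduct, Fin.sum_univ_three]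
  · have e : t⁻¹ * t ^ 2 = t := by field_simp
    funext i; fin_cases i <;> simp [Matrix.mulVec, dotProduct, Fin.sum_univ_three, e]

end CharThreeTorsion

end Literature.AlgebraicGeometry.PlaneCurves
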